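import Literature.Barriers.ResolutionOfSingularities.NarasimhanMaximalContact
import Literature.AlgebraicGeometry.Hironaka2017.WQWitness
import HarnessLib

/-!
# Barrier: an intrinsic stratum through a torus point of the W-Q specimen contains a curve of FULL embedding dimension —
# no regular hypersurface germ (hence no regular proper «cut») contains it («SigmaMaxContainsFullEdimCurve»)

`Literature/Barriers/ResolutionOfSingularities/SigmaMaxContainsFullEdimCurve.lean` — barrier catalogue entry (D-0021) for
the summit `ResolutionOfSingularities`, filed at the request of the LADDER-RESOLUTION cell `res-hironaka` (director-resolution
2026-08-27T02:30:27Z (1) / 02:47:48Z; candidate #2 of the carver queue; source: kill-test report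
`pub/res-hironaka/L/res-L1-k32/KILL-TEST-K3.2second.md` sha16 `8d42db450ede9e27` (res-L1-k32 gen 3), §4 «hit in the STRONGER form
«not only the top locus but Σ_max(Inv) itself contains a monomial curve of embedding dimension n through 0»»; kernel specimen
layers already in the tree: `Literature.AlgebraicGeometry.Hironaka2017.WQWitness` (the W-Q witness `fW`, its torus, the
embedding-dimension lemmas `edim_gamma_*`), `Summits/…/Theorems/MarkedTransferCampaignW32K32Second{W,Z}Axis` p485247 / p485262
(local forms at the axis points)). Companion and template: `NarasimhanMaximalContact.lean` (same directory), whose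
`orderTwoLocus` / `IsSmoothAtOrigin` this entry reuses and whose semigroup argument it re-proves for an arbitrary number of
variables. Everything below is PROVED; what is NOT kernel-checked is said in `scope_caveats`.

## The phenomenon (checkable ∀-statement; the specimen is the kernel witness)

Let `e = (e₀, …, e_{n−1})` be positive integers none of which lies in the numerical semigroup generated by the others, and let
`γ_e(t) = (t^{e₀}, …, t^{e_{n−1}})` be the monomial curve through `P₀ = γ_e(1) = (1, …, 1)`; it is the orbit closure of `P₀` under the
one-parameter torus `λ · (x_i) = (λ^{e_i} x_i)`. THEN (`FullEdimCurve.not_isSmoothAtOrigin_of_torusStable`): over an infinite field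
`k`, NO subset `S ⊆ kⁿ` that is stable under that torus and contains `P₀` lies in a hypersurface `F = 0` through the origin that is
smooth there — `F ∘ γ_e ≡ 0` kills every linear coefficient of `F` (`FullEdimCurve.linearPart_eq_zero_of_aeval_eq_zero`, the
semigroup argument of [cite: Kollar2007, Aside 3.57] in `n` variables). Equivalently `S` has embedding dimension `n` at `0`: it
is contained in no regular proper subvariety germ through `0`, in particular its closure is not itself a regular germ of
dimension `< n`.

**Specimen = the W-Q witness** (`WQSigmaMax.*`): `Z = 𝔸⁵`, `char k = 2`, `E = (fW, 2)`,
`fW = x² + wv⁶ + zw⁵v² + yz²wv⁴ + yz³w⁵ + yz⁹ + y⁴zw²v² + y¹¹` (`WQWitness.fW`), weights `e = (99, 18, 20, 24, 29)` — none in the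
semigroup of the others (`WQWitness.edim_gamma_99/_18/_20/_24/_29`, re-packaged as `WQSigmaMax.weight_eq_exp_iff`). Kernel facts
proved here: `P₀ = (1,1,1,1,1)` and every `γ(t) = (t⁹⁹, t¹⁸, t²⁰, t²⁴, t²⁹)` lie in the order-`2` (= singular = top-multiplicity) locus
`V(fW, ∂fW)` (`WQSigmaMax.wqPoint_mem_orderTwoLocus`; `fW ∘ γ = 8T¹⁹⁸`, `∂fW ∘ γ ∈ {0, 14T¹⁸⁰, 14T¹⁷⁸, 12T¹⁷⁴, 14T¹⁶⁹}` — all `≡ 0 (mod 2)`),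
so does the `w`-axis (`wAxis_mem_orderTwoLocus`), and `V(fW, ∂fW)` is stable under the torus (`torus_mem_orderTwoLocus`; `fW` is
quasi-homogeneous of degree `198`, `WQWitness.torus_fW`). Consequence (`WQ_noSmoothHypersurfaceThroughTorusStratum`): over an
infinite field of characteristic `2`, no torus-stable subset of `𝔸⁵(k)` containing `P₀` — e.g. `V(fW, ∂fW)` itself, or ANY
stratum through `P₀` of ANY stratification of `Sing(E)` by an invariant of the pair `(Z, E)` (such strata are permuted by
`Aut(Z, E) ⊇` the torus) — lies in a hypersurface smooth at `0`.

## Application recorded here (cell res-hironaka, D-0089; HONEST FRAMING)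

H. Hironaka, *Resolution of singularities in positive characteristics*, ms. 2017 [Hironaka2017] is an UNREFEREED MANUSCRIPT
UNDER ADJUDICATION (D-0012); its statements are CANDIDATES, never asserted here. The cell's kill tests K3.2 / K3.2′ / K3.2″
(res-L1-k32, reports in `pub/res-hironaka/L/res-L1-k32/`) computed — by HAND STEPS over LIVE FACT-LIST rows (F-21e valuative
criterion for `℘`, F-20a Diff theorem, F-09 Hasse–Schmidt) plus exact `𝔽_p` kit arithmetic (job j264724) and the kernel local
certificates p485247 / p485262 — that on this specimen the top stratum of the manuscript's invariant `Inv` of Eq. (34) p.24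
(«`Σ_max(Inv)`», the locus Eq. (43) p.30 works with) is `T_c = {0} ∪ (w-axis) ∪ γ̄ ∋ P₀`, with `Inv ≡ (5,4,2)` there
[claim: Hironaka2017, status: under-review] (the definitions are the manuscript's; the computation is OURS and is NOT
kernel-checked — see `scope_caveats`). GIVEN that identification, this entry says: `Σ̄_max(Inv)` contains the curve `γ̄` of embedding
dimension `5` at `0`, so no regular hypersurface germ at `0` contains `Σ̄_max`, a fortiori `Σ̄_max` is not a regular germ and cannot
serve as a regular centre / «RegularCut» at `0` (cell rows R12/12a; K3.2″ verdict «(V-c) DOES-NOT-SUPPLY»). The entry's ∀-statement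
needs only «torus-stable and `∋ P₀`», which EVERY intrinsic stratum through `P₀` satisfies. Nothing here is a claim about resolution
of singularities in characteristic `p`, nor a verdict on any printed sentence.

## Sources (page-checked locators are those of the companion entry `NarasimhanMaximalContact`, re-used, not re-read tonight)

* Kollár, *Lectures on Resolution of Singularities* (2007), Aside 3.57: the semigroup argument «one of `x, y, z, w` appears
  linearly in `F` and `F(t³², t⁷, t¹⁹, t¹⁵) ≡ 0` … impossible since none of the numbers … is a positive linear combination of
  the other three» [cite: Kollar2007, Aside 3.57]; Hauser (2003) §14 Example 1 «the top locus of an ideal may not be contained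
  locally in a regular hypersurface» [cite: Hauser2003, §14 Example 1]; Hauser (2008) §A: the printed repair «refining the usual
  stratification of the singular locus … through the local embedding dimension of this locus» [cite: Hauser2008Kangaroo, §A].
* The specimen: cell res-hironaka prior record WQ-SCREEN (concern C18) = tree `WQWitness` (module docstring there).
-/

noncomputable section

namespace Literature.Barriers.ResolutionOfSingularities

open MvPolynomial

universe u

/-! ## 1. Monomial curves in `n` variables: the semigroup argument, torus-stable sets -/

namespace FullEdimCurve

variable (k : Type u) [CommRing k] {n : ℕ}

/-- The monomial curve `x_i ↦ T^{e_i}` as a substitution into `k[T]`. [cite: Kollar2007, Aside 3.57] -/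
def curve (e : Fin n → ℕ) : Fin n → Polynomial k := fun i => Polynomial.X ^ e i

/-- Its `k`-points `γ_e(t) = (t^{e_i})_i`. [cite: Kollar2007, Aside 3.57] -/
def point (e : Fin n → ℕ) (t : k) : Fin n → k := fun i => t ^ e i

/-- The weight `Σ e_i d_i` of an exponent vector `d` (the `T`-degree of `x^d` along the curve). [cite: Kollar2007, Aside 3.57] -/
def weight (e : Fin n → ℕ) (d : Fin n →₀ ℕ) : ℕ := ∑ i, e i * d i

/-- The one-parameter torus `λ · P = (λ^{e_i} P_i)_i` of weights `e`. [folklore] -/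
def torus (e : Fin n → ℕ) (c : k) (P : Fin n → k) : Fin n → k := fun i => c ^ e i * P i

/-- `γ_e(t) = t · (1, …, 1)`: the curve is the torus orbit of `P₀ = (1, …, 1)`. [folklore] -/
private theorem torus_one (e : Fin n → ℕ) (c : k) : torus k e c (fun _ => 1) = point k e c := by
  funext i; simp [torus, point]

/-- A monomial restricts to `a·T^{weight}` along the curve. [cite: Kollar2007, Aside 3.57] -/
theorem aeval_curve_monomial (e : Fin n → ℕ) (d : Fin n →₀ ℕ) (a : k) :
    aeval (curve k e) (monomial d a) = Polynomial.C a * Polynomial.X ^ weight e d := by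
  rw [aeval_monomial, Finsupp.prod_fintype _ _ (fun i => pow_zero _), Polynomial.algebraMap_eq]
  simp only [curve, ← pow_mul, Finset.prod_pow_eq_pow_sum, weight]

/-- Coefficient extraction along the curve when `d₀` is the unique exponent of weight `m`. [cite: Kollar2007, Aside 3.57] -/
theorem coeff_aeval_curve (e : Fin n → ℕ) (F : MvPolynomial (Fin n) k) (m : ℕ) (d₀ : Fin n →₀ ℕ)
    (huniq : ∀ d, weight e d = m ↔ d = d₀) : (aeval (curve k e) F).coeff m = coeff d₀ F := by
  classical
  induction F using MvPolynomial.induction_on' with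
  | monomial d a =>
    rw [aeval_curve_monomial, Polynomial.coeff_C_mul, Polynomial.coeff_X_pow, coeff_monomial]
    by_cases h : d = d₀
    · subst h
      simp [(huniq d).mpr rfl]
    · have hw : weight e d ≠ m := fun h' => h ((huniq d).mp h')
      simp [h, Ne.symm hw]
  | add p q hp hq => simp [hp, hq, coeff_add]

/-- **Semigroup argument, `n` variables**: if `0` and each `e_i` are uniquely representable in the semigroup `⟨e⟩`, a polynomial
vanishing along `γ_e` has no constant and no linear term. [cite: Kollar2007, Aside 3.57] -/
theorem linearPart_eq_zero_of_aeval_eq_zero (e : Fin n → ℕ) (h0 : ∀ d, weight e d = 0 ↔ d = 0)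
    (h1 : ∀ d i, weight e d = e i ↔ d = Finsupp.single i 1) (F : MvPolynomial (Fin n) k)
    (hF : aeval (curve k e) F = 0) : coeff 0 F = 0 ∧ ∀ i, coeff (Finsupp.single i 1) F = 0 := by
  refine ⟨?_, fun i => ?_⟩
  · rw [← coeff_aeval_curve k e F 0 0 h0, hF, Polynomial.coeff_zero]
  · rw [← coeff_aeval_curve k e F (e i) _ (fun d => h1 d i), hF, Polynomial.coeff_zero]

/-- Evaluating at a point of the curve is evaluating `F ∘ γ_e ∈ k[T]`. [folklore] -/
private theorem eval_point (e : Fin n → ℕ) (F : MvPolynomial (Fin n) k) (t : k) :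
    eval (point k e t) F = (aeval (curve k e) F).eval t := by
  have h := MvPolynomial.comp_aeval_apply (f := curve k e) (Polynomial.aeval t) F
  rw [Polynomial.coe_aeval_eq_eval] at h
  rw [h, ← MvPolynomial.aeval_eq_eval]
  congr 1
  · ext i
    simp [curve, point]

variable {k}

/-- Over an infinite field, a polynomial vanishing at every `γ_e(t)`, `t ≠ 0`, vanishes identically along the curve. [folklore] -/
private theorem aeval_eq_zero_of_eval_point {k : Type u} [Field k] [Infinite k] (e : Fin n → ℕ) (F : MvPolynomial (Fin n) k)
    (hF : ∀ t : k, t ≠ 0 → eval (point k e t) F = 0) : aeval (curve k e) F = 0 := by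
  apply Polynomial.eq_zero_of_infinite_isRoot
  refine Set.Infinite.mono (s := {t : k | t ≠ 0}) (fun t ht => ?_) (Set.finite_singleton (0 : k)).infinite_compl
  rw [Set.mem_setOf_eq, Polynomial.IsRoot.def, ← eval_point]
  exact hF t ht

/-- **The barrier mechanism, abstract form.** `k` an infinite field, `e` positive weights with `0` and each `e_i` uniquely
representable in `⟨e⟩` (the curve `γ_e` has embedding dimension `n` at `0`): a subset `S ⊆ kⁿ` that is stable under the torus of
weights `e` and contains `P₀ = (1, …, 1)` lies in NO hypersurface through `0` that is smooth at `0`. [cite: Kollar2007, Aside 3.57] -/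
theorem not_isSmoothAtOrigin_of_torusStable {k : Type u} [Field k] [Infinite k] (e : Fin n → ℕ)
    (h0 : ∀ d, weight e d = 0 ↔ d = 0) (h1 : ∀ d i, weight e d = e i ↔ d = Finsupp.single i 1)
    (S : Set (Fin n → k)) (hS : ∀ c : k, c ≠ 0 → ∀ P ∈ S, torus k e c P ∈ S) (hP₀ : (fun _ => (1 : k)) ∈ S)
    (F : MvPolynomial (Fin n) k) (hF : ∀ P ∈ S, eval P F = 0) : ¬ IsSmoothAtOrigin F := by
  rintro ⟨-, i, hi⟩
  refine hi ((linearPart_eq_zero_of_aeval_eq_zero k e h0 h1 F (aeval_eq_zero_of_eval_point e F fun t ht => ?_)).2 i)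
  rw [← torus_one]
  exact hF _ (hS t ht _ hP₀)

/-- Variant without the torus: any set containing all `γ_e(t)`, `t ≠ 0`. [cite: Kollar2007, Aside 3.57] -/
theorem not_isSmoothAtOrigin_of_curve_subset {k : Type u} [Field k] [Infinite k] (e : Fin n → ℕ)
    (h0 : ∀ d, weight e d = 0 ↔ d = 0) (h1 : ∀ d i, weight e d = e i ↔ d = Finsupp.single i 1)
    (S : Set (Fin n → k)) (hS : ∀ t : k, t ≠ 0 → point k e t ∈ S)
    (F : MvPolynomial (Fin n) k) (hF : ∀ P ∈ S, eval P F = 0) : ¬ IsSmoothAtOrigin F := by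
  rintro ⟨-, i, hi⟩
  exact hi ((linearPart_eq_zero_of_aeval_eq_zero k e h0 h1 F
    (aeval_eq_zero_of_eval_point e F fun t ht => hF _ (hS t ht))).2 i)

end FullEdimCurve

/-! ## 2. The specimen: the W-Q witness `E = (fW, 2) ⊂ 𝔸⁵`, characteristic `2`, weights `(99, 18, 20, 24, 29)` -/

namespace WQSigmaMax

open Literature.AlgebraicGeometry.Hironaka2017.WQWitness (fW edim_gamma_99 edim_gamma_18 edim_gamma_20
  edim_gamma_24 edim_gamma_29)

/-- The weights `(99, 18, 20, 24, 29)` of the W-Q torus / the exponents of the curve `γ`. [folklore] -/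
def wqExp : Fin 5 → ℕ := ![99, 18, 20, 24, 29]

/-- `e₀ = 99`. [folklore] -/
@[simp] private theorem wqExp_zero : wqExp 0 = 99 := rfl
/-- `e₁ = 18`. [folklore] -/
@[simp] private theorem wqExp_one : wqExp 1 = 18 := rfl
/-- `e₂ = 20`. [folklore] -/
@[simp] private theorem wqExp_two : wqExp 2 = 20 := rfl
/-- `e₃ = 24`. [folklore] -/
@[simp] private theorem wqExp_three : wqExp 3 = 24 := rfl
/-- `e₄ = 29`. [folklore] -/
@[simp] private theorem wqExp_four : wqExp 4 = 29 := rfl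

/-- The weight written out. [folklore] -/
private theorem weight_wq_apply (d : Fin 5 →₀ ℕ) :
    FullEdimCurve.weight wqExp d = 99 * d 0 + 18 * d 1 + 20 * d 2 + 24 * d 3 + 29 * d 4 := by
  simp [FullEdimCurve.weight, Fin.sum_univ_succ]
  ring

/-- Weight `0` only for the zero exponent. [claim: Hironaka2017, status: under-review]
STATUS: kernel fact about the cell's OWN specimen (prior record C18, tree `WQWitness`), bearing on Eq. (43) p.30 / Rem. 15.4 p.76; nothing of the manuscript is asserted (D-0012/D-0089). -/
theorem weight_wq_eq_zero_iff (d : Fin 5 →₀ ℕ) : FullEdimCurve.weight wqExp d = 0 ↔ d = 0 := by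
  rw [weight_wq_apply]
  constructor
  · intro h
    ext j; fin_cases j <;> simp <;> omega
  · rintro rfl; simp

/-- `γ = (t⁹⁹, t¹⁸, t²⁰, t²⁴, t²⁹)` has embedding dimension `5` at `0`: each weight `e_i` is attained only by `x_i` (the tree's
`WQWitness.edim_gamma_*`: no exponent lies in the semigroup of the other four). [claim: Hironaka2017, status: under-review]
STATUS: kernel fact about the cell's OWN specimen (prior record C18, tree `WQWitness`), bearing on Eq. (43) p.30 / Rem. 15.4 p.76; nothing of the manuscript is asserted (D-0012/D-0089). -/
theorem weight_wq_eq_exp_iff (d : Fin 5 →₀ ℕ) (i : Fin 5) :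
    FullEdimCurve.weight wqExp d = wqExp i ↔ d = Finsupp.single i 1 := by
  rw [weight_wq_apply]
  constructor
  · intro h
    fin_cases i
    · have h' : 99 * d 0 + 18 * d 1 + 20 * d 2 + 24 * d 3 + 29 * d 4 = 99 := h
      by_cases h0 : d 0 = 0
      · exact absurd (by rw [h0] at h'; omega) (edim_gamma_99 (d 1) (d 2) (d 3) (d 4))
      · ext j; fin_cases j <;> simp <;> omega
    · have h' : 99 * d 0 + 18 * d 1 + 20 * d 2 + 24 * d 3 + 29 * d 4 = 18 := h
      by_cases h0 : d 1 = 0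
      · exact absurd (by rw [h0] at h'; omega) (edim_gamma_18 (d 0) (d 2) (d 3) (d 4))
      · ext j; fin_cases j <;> simp <;> omega
    · have h' : 99 * d 0 + 18 * d 1 + 20 * d 2 + 24 * d 3 + 29 * d 4 = 20 := h
      by_cases h0 : d 2 = 0
      · exact absurd (by rw [h0] at h'; omega) (edim_gamma_20 (d 0) (d 1) (d 3) (d 4))
      · ext j; fin_cases j <;> simp <;> omega
    · have h' : 99 * d 0 + 18 * d 1 + 20 * d 2 + 24 * d 3 + 29 * d 4 = 24 := h
      by_cases h0 : d 3 = 0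
      · exact absurd (by rw [h0] at h'; omega) (edim_gamma_24 (d 0) (d 1) (d 2) (d 4))
      · ext j; fin_cases j <;> simp <;> omega
    · have h' : 99 * d 0 + 18 * d 1 + 20 * d 2 + 24 * d 3 + 29 * d 4 = 29 := h
      by_cases h0 : d 4 = 0
      · exact absurd (by rw [h0] at h'; omega) (edim_gamma_29 (d 0) (d 1) (d 2) (d 3))
      · ext j; fin_cases j <;> simp <;> omega
  · rintro rfl
    fin_cases i <;> simp

variable (k : Type u) [Field k]

/-- `fW ∘ γ = 8·T¹⁹⁸`, hence `0` in characteristic `2`: the curve lies on the hypersurface. [claim: Hironaka2017, status: under-review]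
STATUS: kernel fact about the cell's OWN specimen (prior record C18, tree `WQWitness`), bearing on Eq. (43) p.30 / Rem. 15.4 p.76; nothing of the manuscript is asserted (D-0012/D-0089). -/
theorem aeval_curve_fW [CharP k 2] : aeval (FullEdimCurve.curve k wqExp) (fW (R := k)) = 0 := by
  simp only [fW, FullEdimCurve.curve, map_add, map_mul, map_pow, aeval_X, wqExp_zero, wqExp_one, wqExp_two,
    wqExp_three, wqExp_four]
  ring_nf
  reduce_mod_char!

/-- All first partials of `fW` vanish along `γ` in characteristic `2` (`∂ₓ = 2x`; the others restrict to `14T¹⁸⁰`, `14T¹⁷⁸`,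
`12T¹⁷⁴`, `14T¹⁶⁹`). [claim: Hironaka2017, status: under-review]
STATUS: kernel fact about the cell's OWN specimen (prior record C18, tree `WQWitness`), bearing on Eq. (43) p.30 / Rem. 15.4 p.76; nothing of the manuscript is asserted (D-0012/D-0089). -/
theorem aeval_curve_pderiv_fW [CharP k 2] (i : Fin 5) :
    aeval (FullEdimCurve.curve k wqExp) (pderiv i (fW (R := k))) = 0 := by
  fin_cases i <;>
  · simp [fW, FullEdimCurve.curve]
    ring_nf
    try reduce_mod_char!

/-- Every `γ(t)` lies in the order-`2` (= singular) locus `V(fW, ∂fW)` (`orderTwoLocus` of the companion entry). [claim: Hironaka2017, status: under-review]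
STATUS: kernel fact about the cell's OWN specimen (prior record C18, tree `WQWitness`), bearing on Eq. (43) p.30 / Rem. 15.4 p.76; nothing of the manuscript is asserted (D-0012/D-0089). -/
theorem wqPoint_mem_orderTwoLocus [CharP k 2] (t : k) :
    FullEdimCurve.point k wqExp t ∈ orderTwoLocus (fW (R := k)) := by
  refine ⟨?_, fun i => ?_⟩
  · rw [FullEdimCurve.eval_point, aeval_curve_fW, Polynomial.eval_zero]
  · rw [FullEdimCurve.eval_point, aeval_curve_pderiv_fW, Polynomial.eval_zero]

/-- `P₀ = (1,1,1,1,1) = γ(1)` lies in the order-`2` locus. [claim: Hironaka2017, status: under-review]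
STATUS: kernel fact about the cell's OWN specimen (prior record C18, tree `WQWitness`), bearing on Eq. (43) p.30 / Rem. 15.4 p.76; nothing of the manuscript is asserted (D-0012/D-0089). -/
theorem one_mem_orderTwoLocus [CharP k 2] : (fun _ => (1 : k)) ∈ orderTwoLocus (fW (R := k)) := by
  have h := wqPoint_mem_orderTwoLocus k 1
  rwa [show FullEdimCurve.point k wqExp 1 = fun _ => (1 : k) from by funext i; simp [FullEdimCurve.point]] at h

/-- The `w`-axis `(0, 0, 0, c, 0)` lies in the order-`2` locus (every characteristic). [claim: Hironaka2017, status: under-review]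
STATUS: kernel fact about the cell's OWN specimen (prior record C18, tree `WQWitness`), bearing on Eq. (43) p.30 / Rem. 15.4 p.76; nothing of the manuscript is asserted (D-0012/D-0089). -/
theorem wAxis_mem_orderTwoLocus (c : k) : (![0, 0, 0, c, 0] : Fin 5 → k) ∈ orderTwoLocus (fW (R := k)) := by
  refine ⟨?_, fun i => ?_⟩
  · simp [fW]
  · fin_cases i <;> simp [fW]

/-- Quasi-homogeneity of `fW` (degree `198`) at `k`-points: `fW(λ·P) = λ¹⁹⁸ fW(P)` (cf. `WQWitness.torus_fW`). [claim: Hironaka2017, status: under-review]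
STATUS: kernel fact about the cell's OWN specimen (prior record C18, tree `WQWitness`), bearing on Eq. (43) p.30 / Rem. 15.4 p.76; nothing of the manuscript is asserted (D-0012/D-0089). -/
theorem eval_torus_fW (c : k) (P : Fin 5 → k) :
    eval (FullEdimCurve.torus k wqExp c P) (fW (R := k)) = c ^ 198 * eval P (fW (R := k)) := by
  simp only [fW, FullEdimCurve.torus, map_add, map_mul, map_pow, eval_X, wqExp_zero, wqExp_one, wqExp_two, wqExp_three,
    wqExp_four]
  ring

/-- Quasi-homogeneity of the partials: `(∂_i fW)(λ·P) = λ^{198 − e_i} (∂_i fW)(P)`. [claim: Hironaka2017, status: under-review]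
STATUS: kernel fact about the cell's OWN specimen (prior record C18, tree `WQWitness`), bearing on Eq. (43) p.30 / Rem. 15.4 p.76; nothing of the manuscript is asserted (D-0012/D-0089). -/
theorem eval_torus_pderiv_fW (c : k) (P : Fin 5 → k) (i : Fin 5) :
    ∃ m : ℕ, eval (FullEdimCurve.torus k wqExp c P) (pderiv i (fW (R := k))) = c ^ m * eval P (pderiv i (fW (R := k))) := by
  fin_cases i
  · exact ⟨99, by simp [fW, FullEdimCurve.torus]; ring⟩
  · exact ⟨180, by simp [fW, FullEdimCurve.torus]; ring⟩
  · exact ⟨178, by simp [fW, FullEdimCurve.torus]; ring⟩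
  · exact ⟨174, by simp [fW, FullEdimCurve.torus]; ring⟩
  · exact ⟨169, by simp [fW, FullEdimCurve.torus]; ring⟩

/-- The order-`2` locus of `fW` is stable under the torus of weights `(99, 18, 20, 24, 29)` (`fW` is quasi-homogeneous of
degree `198`, `WQWitness.torus_fW`; the partials are quasi-homogeneous of degrees `198 − e_i`). [claim: Hironaka2017, status: under-review]
STATUS: kernel fact about the cell's OWN specimen (prior record C18, tree `WQWitness`), bearing on Eq. (43) p.30 / Rem. 15.4 p.76; nothing of the manuscript is asserted (D-0012/D-0089). -/
theorem torus_mem_orderTwoLocus (c : k) {P : Fin 5 → k} (hP : P ∈ orderTwoLocus (fW (R := k))) :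
    FullEdimCurve.torus k wqExp c P ∈ orderTwoLocus (fW (R := k)) := by
  obtain ⟨h0, h⟩ := hP
  refine ⟨by rw [eval_torus_fW, h0, mul_zero], fun i => ?_⟩
  obtain ⟨m, hm⟩ := eval_torus_pderiv_fW k c P i
  rw [hm, h i, mul_zero]

end WQSigmaMax

/-! ## 3. The barrier statements -/

/-- **The W-Q specimen instance, proved**: over every infinite field `k` of characteristic `2`, NO subset `S` of `𝔸⁵(k)` that is
stable under the torus `λ · (x,y,z,w,v) = (λ⁹⁹x, λ¹⁸y, λ²⁰z, λ²⁴w, λ²⁹v)` and contains `P₀ = (1,1,1,1,1)` lies in a hypersurface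
`F = 0` through the origin that is smooth there; `P₀`, the whole curve `γ(t) = (t⁹⁹, t¹⁸, t²⁰, t²⁴, t²⁹)` and the `w`-axis lie in the
order-`2` locus `V(fW, ∂fW)` of the W-Q witness `fW`, which is such a set. [cite: Kollar2007, Aside 3.57] -/
theorem WQ_noSmoothHypersurfaceThroughTorusStratum (k : Type u) [Field k] [CharP k 2] [Infinite k] (S : Set (Fin 5 → k))
    (hS : ∀ c : k, c ≠ 0 → ∀ P ∈ S, FullEdimCurve.torus k WQSigmaMax.wqExp c P ∈ S) (hP₀ : (fun _ => (1 : k)) ∈ S) :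
    ¬ ∃ F : MvPolynomial (Fin 5) k, IsSmoothAtOrigin F ∧ ∀ P ∈ S, eval P F = 0 := by
  rintro ⟨F, hsm, hF⟩
  exact FullEdimCurve.not_isSmoothAtOrigin_of_torusStable WQSigmaMax.wqExp WQSigmaMax.weight_wq_eq_zero_iff
    WQSigmaMax.weight_wq_eq_exp_iff S hS hP₀ F hF hsm

/-- **Barrier («SigmaMaxContainsFullEdimCurve»), proved.** For every `n`, every weight vector `e ∈ ℕ^n_{>0}` with `0` and each
`e_i` uniquely representable in the semigroup `⟨e⟩` (the monomial curve `γ_e` has embedding dimension `n` at `0`), and every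
infinite field `k`: a subset `S ⊆ 𝔸ⁿ(k)` that is stable under the torus `λ·x = (λ^{e_i}x_i)` and contains `P₀ = (1,…,1)` —
hence contains the punctured curve `γ_e(k^×)` — lies in NO hypersurface through `0` smooth at `0`; i.e. `S` has embedding
dimension `n` at the origin, so it is contained in no regular proper subvariety germ through `0` and its closure is not a
regular germ of dimension `< n`. Specimen (kernel witness, §2): the W-Q hypersurface `E = (fW, 2) ⊂ 𝔸⁵` in characteristic `2`
with `e = (99,18,20,24,29)` (`WQ_noSmoothHypersurfaceThroughTorusStratum`, `WQSigmaMax.one_mem_orderTwoLocus`,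
`wqPoint_mem_orderTwoLocus`, `wAxis_mem_orderTwoLocus`, `torus_mem_orderTwoLocus`). Mechanism = Kollár's semigroup argument
[cite: Kollar2007, Aside 3.57] in `n` variables (`FullEdimCurve.linearPart_eq_zero_of_aeval_eq_zero`); «the top locus of an ideal
may not be contained locally in a regular hypersurface» [cite: Hauser2003, §14 Example 1].

Technique class, in prose: «canonical strata as regular cuts / foci»: take the top stratum `Σ_max` of an INTRINSIC
upper-semicontinuous invariant of `(Z, E)` (multiplicity, Hilbert–Samuel, `(HS, e)`, the manuscript's `Inv` of Eq. (34), …),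
close it up, and use `Σ̄_max` — or a regular hypersurface / regular subscheme containing it — as the centre, the «focus», or
the ambient space of an induction («RegularCut»). Intrinsic strata are `Aut(Z,E)`-stable, hence torus-stable on a quasi-homogeneous
specimen, and the entry applies to every such stratum through a torus point `P₀` whose orbit closure has full embedding dimension.

BARRIER (D-0021):
- technique_class: canonical-strata regular-cut-as-focus top-locus-as-centre intrinsic-stratification sigma-max embedding-dimension torus-orbit maximal-contact-containment positive-characteristic
- blocks: (1) every format that needs, at a point `0` of a quasi-homogeneous pair `(𝔸ⁿ, E)`, a regular hypersurface germ (or any regular proper subvariety germ) CONTAINING an intrinsic stratum `S ∋ P₀` whose torus orbit closure `γ̄_e ∋ 0` has full embedding dimension — on the W-Q specimen: containing `V(fW, ∂fW) = Sing(E)`, or containing ANY `Aut`-stable stratum through `P₀ = (1,1,1,1,1)` (`WQ_noSmoothHypersurfaceThroughTorusStratum`); (2) in particular the cell res-hironaka's rows R12/12a «RegularCut» and line W3.2 variant (V-c) = «the `(HS, e)`-top stratum supplies the regular cut where `Σ̄_max(Ê)` is singular»: kill test K3.2″ (res-L1-k32, report 8d42db450ede9e27 §4) found `T_c = Σ_max(Inv)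 = {0} ∪ w-axis ∪ γ̄ ∋ P₀` on W2 (and the analogue on the companion W2′ ⊂ 𝔸⁴, `char 3`), verdict «DOES-NOT-SUPPLY» — with the identification `Σ_max(Inv) ∋ P₀` (HAND + kit j264724, see scope (b)) the present entry is the formal reason: `Σ̄_max` contains `γ̄` of embedding dimension `5` (Eq. (34) p.24 / Eq. (43) p.30 define `Inv` / `Σ_max`; nothing of the manuscript is asserted) [claim: Hironaka2017, status: under-review]; (3) the manuscript's Rem. 15.4 / Eq. (119) / Def. 15.5 requirement of smooth `Y_{j0} ⊇ Sing(Ě) ∩ V_0` at `ξ = 0` on this specimen (prior record C18, `WQWitness` module docstring) [claim: Hironaka2017, status: under-review].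
- because: `F ∘ γ_e ≡ 0` and unique representability of each `e_i` in `⟨e⟩` force every linear coefficient of `F` to vanish (`FullEdimCurve.coeff_aeval_curve`, `linearPart_eq_zero_of_aeval_eq_zero`) [cite: Kollar2007, Aside 3.57]; a torus-stable set through `P₀` contains `γ_e(k^×)`, which is Zariski-dense in `γ_e` over an infinite field (`aeval_eq_zero_of_eval_point`); for the specimen, `fW ∘ γ = 8T¹⁹⁸`, `∂fW ∘ γ ∈ {0, 14T¹⁸⁰, 14T¹⁷⁸, 12T¹⁷⁴, 14T¹⁶⁹}` vanish mod `2` and `V(fW, ∂fW)` is torus-stable by quasi-homogeneity (`WQWitness.torus_fW`; `WQSigmaMax.torus_mem_orderTwoLocus`), while `99, 18, 20, 24, 29` are each outside the semigroup of the other four (`WQWitness.edim_gamma_*`).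
- evasions_known: (i) REFINE the stratification by the local embedding dimension of the stratum (Hauser's printed repair: «It can, however, be realized by refining the usual stratification of the singular locus of `J` through the local embedding dimension of this locus» [cite: Hauser2008Kangaroo, §A]) — the refined top stratum at `0` is `{0}`, regular; (ii) do not require the cut to CONTAIN the stratum: a non-faithful stratifier that changes the top stratum (cell note: o4's `eq_topClosure_of_cut` — a faithful one cannot), weak / non-embedded maximal contact, or descent by smooth projections instead of embedded hypersurfaces [cite: Hauser2003, §4 (problem (9))]; (iii) avoid maximal-contact-type containment altogether (characteristic polyhedra, Cossart–Piltant in dimension 3, alterations — see the companion entry's evasions [cite: Kollar2007, Aside 3.57]); (iv) blow up the point `0` first and re-stratify: the containment obstruction is a statement at ONE point and stage (companion entry `NarasimhanMaximalContactNarrow`: on Narasimhan's example it disappears after two equiconstant blow-ups) — on the W-Q specimen the cell's K3.5 (res-L1-k35) found instead that the bare-`Inv` top stratum SPREADS over the exceptional `ℙ³` (candidate «StratumFirstInvIncrease», RESCUE-SEED §7d), so (iv) is not an evasion there for that invariant.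
- scope_caveats: (a) PROVED: the abstract ∀-statement for every `n`, `e`, infinite `k` (polynomial hypersurfaces, `k`-points; the formal-germ version — `F ∈ k⟦x⟧` with `F(T^{e}) = 0` — is the companion entry's `linearPart_eq_zero_of_subst_curve_eq_zero` pattern and is NOT restated here), and for the specimen: `P₀`, `γ(t)`, the `w`-axis `∈ V(fW, ∂fW)` and torus-stability of `V(fW, ∂fW)`, in characteristic `2`; (b) NOT kernel-checked: that the top stratum of the manuscript's `Inv` (or of `(HS, e)`) on the specimen IS `{0} ∪ w-axis ∪ γ̄` — this is the cell's K3.2/K3.2′/K3.2″ computation (hand steps H1–H4 over FACT-LIST rows F-21e/F-20a/F-09 + kit job j264724 + kernel local certificates p485247/p485262 + the prior LSB certificates `WQWitness.lsb_E/lsb_H`), cited, not imported; the entry is APPLIED to `Σ_max(Inv)` through the weaker, structural input «intrinsic strata are torus-stable; `P₀ ∈ Σ_max`», of which only the second half is specimen-specific hand knowledge; (c) the `k`-point formulation needs `k` infinite (over a finite field a polynomial may vanish on all `k`-points of `γ`); (d) the companion W2′ = `(x³ + G, 3) ⊂ 𝔸⁴`, `char 3`, weights `(41; 9, 12, 13)`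 (`WQ3Witness`, `edim_gamma_41/_9/_12/_13`) satisfies the same abstract hypotheses; its curve/partials identities are not re-derived in this file; (e) nothing here bears on the EXISTENCE of resolutions in characteristic `p`, on stratifiers that are not `Aut(Z,E)`-invariant, or on what happens after blowing up (see evasion (iv)).
- status: established (kernel-checked: abstract form for all `n`; specimen W2 in characteristic `2`)
-/
theorem SigmaMaxContainsFullEdimCurve :
    (∀ (k : Type u) [Field k] [Infinite k] (n : ℕ) (e : Fin n → ℕ),
        (∀ d, FullEdimCurve.weight e d = 0 ↔ d = 0) → (∀ d i, FullEdimCurve.weight e d = e i ↔ d = Finsupp.single i 1) →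
        ∀ S : Set (Fin n → k), (∀ c : k, c ≠ 0 → ∀ P ∈ S, FullEdimCurve.torus k e c P ∈ S) → (fun _ => (1 : k)) ∈ S →
          ¬ ∃ F : MvPolynomial (Fin n) k, IsSmoothAtOrigin F ∧ ∀ P ∈ S, eval P F = 0) ∧
    (∀ (k : Type u) [Field k] [CharP k 2] [Infinite k],
        (fun _ => (1 : k)) ∈ orderTwoLocus (Literature.AlgebraicGeometry.Hironaka2017.WQWitness.fW (R := k)) ∧
        (∀ c : k, c ≠ 0 → ∀ P ∈ orderTwoLocus (Literature.AlgebraicGeometry.Hironaka2017.WQWitness.fW (R := k)),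
            FullEdimCurve.torus k WQSigmaMax.wqExp c P ∈
              orderTwoLocus (Literature.AlgebraicGeometry.Hironaka2017.WQWitness.fW (R := k))) ∧
        ¬ ∃ F : MvPolynomial (Fin 5) k, IsSmoothAtOrigin F ∧
            ∀ P ∈ orderTwoLocus (Literature.AlgebraicGeometry.Hironaka2017.WQWitness.fW (R := k)), eval P F = 0) := by
  refine ⟨fun k _ _ n e h0 h1 S hS hP₀ => ?_, fun k _ _ _ => ⟨WQSigmaMax.one_mem_orderTwoLocus k,
    fun c _ P hP => WQSigmaMax.torus_mem_orderTwoLocus k c hP, ?_⟩⟩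
  · rintro ⟨F, hsm, hF⟩
    exact FullEdimCurve.not_isSmoothAtOrigin_of_torusStable e h0 h1 S hS hP₀ F hF hsm
  · exact WQ_noSmoothHypersurfaceThroughTorusStratum k _ (fun c _ P hP => WQSigmaMax.torus_mem_orderTwoLocus k c hP)
      (WQSigmaMax.one_mem_orderTwoLocus k)

end Literature.Barriers.ResolutionOfSingularities

end
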